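import Mathlib
import Literature.NumberTheory.LFunctions.Zhang2022.Section4Lemma44WideHolds
import Literature.NumberTheory.LFunctions.Zhang2022.Section17ExactGammaWeight
import HarnessLib

/-!
# Zhang (2022) §5 Lemma 5.1 / §2 (2.5): the vertical-shift RATIO of the root number is `≍ 1` in a wide
# strip on BOTH sides of the critical line — `½‖Z(s,θ)‖ ≤ ‖Z(s+iv,θ)‖ ≤ 2‖Z(s,θ)‖` — and the size of
# the exact §17 gamma weight `W₃` left of the line, kernel-checked

Topic `Literature/NumberTheory/LFunctions/Zhang2022` (Landau–Siegel audit tree; verdict-neutral).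
Y. Zhang, *Discrete mean estimates and the Landau–Siegel zero*, arXiv:2211.02515v1 (2022)
[Zhang2022LandauSiegel] — **an unrefereed manuscript under adjudication; nothing here asserts or denies
its Theorems 1–2.** LIB-C adapter (ZHANG-L) for the reflection bookkeeping of §§15–17 left of the
critical line (the moves `𝔍(−α) → 𝔍(−1)` of (15.4) and (17.7)).

* `GammaFactor.norm_Zfac_vshift_le_two_and` — for a primitive `θ (mod k)`, `1 ≤ A`, `s = σ + it` with
  `1 − A ≤ σ ≤ A`, `t ≥ 4A`, and a real shift `v` with `|v| ≤ t/2`, `(2|v|+4A+10)|v|/t ≤ ½`: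
  **`‖Z(s+iv,θ)‖ ≤ 2‖Z(s,θ)‖` and `‖Z(s,θ)‖ ≤ 2‖Z(s+iv,θ)‖`.** For `σ > 0` this is the tree's exact
  vertical shift `GammaFactor.Zfac_vertical_shift` (`Z(s+iv) = Z(s)e^{−iv log(kt/2π)}e^{η}`,
  `‖η‖ ≤ (2|v|+4A+10)|v|/t`, so the ratio is `e^{Re η} ∈ [e^{−½}, e^{½}]`); for `σ ≤ 0` it is REFLECTED
  to the point `1 − s̄` (`Re = 1 − σ ∈ [1, A]`) by the tree's exact symmetry
  `GammaFactor.Zfac_mul_conj_Zfac_one_sub_conj` (`Z(s,θ)·conj Z(1−s̄,θ) = 1`);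
* `Typed.Section17.norm_gammaWeight17_le_two` — for every `c′`, all large `D`, every `ψ ∈ Ψ` and
  every `s` with `−2 ≤ Re s ≤ 3`, `|Im s − 2πt₀| ≤ 𝓛₁ + 2`: **`‖W₃(p,ψ(−1),s)‖ ≤ 2`** (`W₃ =
  Z(s+β₁,ψ)/Z(s,ψ)` exactly, `Typed.Section17.Zfac_shift_div_eq_gammaWeight17`; `|b₁| ≤ 1`), i.e. the
  exact weight of `Section17ExactGammaWeight` is bounded on the whole closed rectangle of the move
  `𝔍(−α) → 𝔍(−1)` and beyond.

Theorems only; no definitions, no named facts; axioms standard. WHAT THIS IS NOT: any claim about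
(15.4), (17.7), Theorems 1–2 of the source or Landau–Siegel zeros.

## References

* Y. Zhang, arXiv:2211.02515v1 (2022), §5 Lemma 5.1 (proof) p. 24; §2 (2.2)–(2.5) p. 4; §17 p. 97.
  [cite: Zhang2022LandauSiegel, §5 Lemma 5.1; §2 (2.5); §17 p. 97]
* H. L. Montgomery, R. C. Vaughan, *Multiplicative Number Theory I* (CUP 2007), (10.35), Thm C.1
  (Stirling for `Γ′/Γ`). [cite: MontgomeryVaughan2007, Thm C.1]
-/

noncomputable section

open Complex Real ComplexConjugate

namespace Literature.NumberTheory.LFunctions.Zhang2022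

namespace GammaFactor

variable {k : ℕ} [NeZero k]

/-- The right half (`0 < σ ≤ A`): `‖Z(s+iv)‖ ≤ 2‖Z(s)‖` and `‖Z(s)‖ ≤ 2‖Z(s+iv)‖` from the exact
vertical shift (`e^{‖η‖} ≤ e^{1/2} < 2`). [cite: Zhang2022LandauSiegel, §5 Lemma 5.1 (proof)] -/
theorem norm_Zfac_vshift_le_two_and_of_pos {θ : DirichletCharacter ℂ k} (hθ : θ.IsPrimitive)
    {A σ t v : ℝ} (hA : 1 ≤ A) (hσ0 : 0 < σ) (hσA : σ ≤ A) (ht : 4 * A ≤ t) (hv : |v| ≤ t / 2)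
    (hsmall : (2 * |v| + 4 * A + 10) * |v| / t ≤ 1 / 2) :
    ‖Zfac θ ((σ : ℂ) + t * I + v * I)‖ ≤ 2 * ‖Zfac θ ((σ : ℂ) + t * I)‖ ∧
      ‖Zfac θ ((σ : ℂ) + t * I)‖ ≤ 2 * ‖Zfac θ ((σ : ℂ) + t * I + v * I)‖ := by
  obtain ⟨η, hη, hZ⟩ := Zfac_vertical_shift hθ hA hσ0 hσA ht hv
  have hphase : ‖cexp (-((v : ℂ) * ((Real.log ((k : ℝ) * t / (2 * π)) : ℝ) : ℂ)) * I)‖ = 1 := by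
    rw [Complex.norm_exp]
    simp
  have hη' : ‖η‖ ≤ 1 / 2 := hη.trans hsmall
  have hre12 := abs_le.mp ((Complex.abs_re_le_norm η).trans hη')
  have hre1 : η.re ≤ 1 / 2 := hre12.2
  have hre2 : -(1 / 2) ≤ η.re := hre12.1
  have hexp_le : ‖cexp η‖ ≤ 2 := by
    rw [Complex.norm_exp]
    calc Real.exp η.re ≤ Real.exp (1 / 2) := Real.exp_le_exp.mpr hre1
      _ ≤ 2 := by
          have h := Real.exp_one_lt_d9
          have h2 : Real.exp (1 / 2) * Real.exp (1 / 2) = Real.exp 1 := by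
            rw [← Real.exp_add]; norm_num
          nlinarith [Real.exp_pos (1 / 2 : ℝ)]
  have hexp_ge : 1 / 2 ≤ ‖cexp η‖ := by
    rw [Complex.norm_exp]
    calc (1 / 2 : ℝ) ≤ Real.exp (-(1 / 2)) := by
          have h := Real.add_one_le_exp (-(1 / 2 : ℝ))
          linarith
      _ ≤ Real.exp η.re := Real.exp_le_exp.mpr hre2
  set Z0 := Zfac θ ((σ : ℂ) + t * I) with hZ0
  have hnorm : ‖Zfac θ ((σ : ℂ) + t * I + v * I)‖ = ‖Z0‖ * ‖cexp η‖ := by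
    rw [hZ, norm_mul, norm_mul, hphase, mul_one]
  constructor
  · rw [hnorm]
    calc ‖Z0‖ * ‖cexp η‖ ≤ ‖Z0‖ * 2 := mul_le_mul_of_nonneg_left hexp_le (norm_nonneg _)
      _ = 2 * ‖Z0‖ := by ring
  · rw [hnorm]
    calc ‖Z0‖ = 2 * (‖Z0‖ * (1 / 2)) := by ring
      _ ≤ 2 * (‖Z0‖ * ‖cexp η‖) := by gcongr

/-- **`½‖Z(s,θ)‖ ≤ ‖Z(s+iv,θ)‖ ≤ 2‖Z(s,θ)‖` in the wide strip `1 − A ≤ σ ≤ A`** (`θ` primitive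
mod `k`, `1 ≤ A`, `t ≥ 4A`, `|v| ≤ t/2`, `(2|v|+4A+10)|v|/t ≤ ½`): right of `σ = 0` by the exact
vertical shift, left of it by reflection to `1 − s̄` (`Z(s,θ)·conj Z(1−s̄,θ) = 1`, so
`‖Z(s+iv)‖/‖Z(s)‖ = ‖Z(w)‖/‖Z(w+iv)‖` with `w = 1−s̄`, `Re w = 1−σ ∈ [1, A]`).
[cite: Zhang2022LandauSiegel, §5 Lemma 5.1 (proof); §2 (2.2), (2.5)] -/
theorem norm_Zfac_vshift_le_two_and {θ : DirichletCharacter ℂ k} (hθ : θ.IsPrimitive)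
    {A σ t v : ℝ} (hA : 1 ≤ A) (hσ1 : 1 - A ≤ σ) (hσA : σ ≤ A) (ht : 4 * A ≤ t) (hv : |v| ≤ t / 2)
    (hsmall : (2 * |v| + 4 * A + 10) * |v| / t ≤ 1 / 2) :
    ‖Zfac θ ((σ : ℂ) + t * I + v * I)‖ ≤ 2 * ‖Zfac θ ((σ : ℂ) + t * I)‖ ∧
      ‖Zfac θ ((σ : ℂ) + t * I)‖ ≤ 2 * ‖Zfac θ ((σ : ℂ) + t * I + v * I)‖ := by
  rcases lt_or_ge 0 σ with hσ0 | hσ0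
  · exact norm_Zfac_vshift_le_two_and_of_pos hθ hA hσ0 hσA ht hv hsmall
  · -- reflect: `w = 1 − s̄ = (1 − σ) + it`, `w + iv = 1 − conj(s + iv)`
    have ht0 : 0 < t := by linarith
    have htv : 0 < t + v := by linarith [neg_abs_le v]
    have hw := norm_Zfac_vshift_le_two_and_of_pos hθ hA (σ := 1 - σ) (by linarith) (by linarith)
      ht hv hsmall
    -- the reflection identities
    have hs_im : (((σ : ℂ) + t * I)).im ≠ 0 := by simp; exact ht0.ne'
    have hsv_im : (((σ : ℂ) + t * I + v * I)).im ≠ 0 := by simp; exact htv.ne'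
    have r0 := Zfac_mul_conj_Zfac_one_sub_conj hθ hs_im
    have r1 := Zfac_mul_conj_Zfac_one_sub_conj hθ hsv_im
    have e0 : (1 : ℂ) - conj ((σ : ℂ) + t * I) = ((1 - σ : ℝ) : ℂ) + t * I := by
      apply Complex.ext <;> simp
    have e1 : (1 : ℂ) - conj ((σ : ℂ) + t * I + v * I) = ((1 - σ : ℝ) : ℂ) + t * I + v * I := by
      apply Complex.ext
      · simp
      · simp; ring
    rw [e0] at r0
    rw [e1] at r1
    -- norms: `‖Z(s)‖·‖Z(w)‖ = 1`, `‖Z(s+iv)‖·‖Z(w+iv)‖ = 1`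
    have n0 : ‖Zfac θ ((σ : ℂ) + t * I)‖ * ‖Zfac θ (((1 - σ : ℝ) : ℂ) + t * I)‖ = 1 := by
      have := congrArg norm r0
      rwa [norm_mul, Complex.norm_conj, norm_one] at this
    have n1 : ‖Zfac θ ((σ : ℂ) + t * I + v * I)‖ *
        ‖Zfac θ (((1 - σ : ℝ) : ℂ) + t * I + v * I)‖ = 1 := by
      have := congrArg norm r1
      rwa [norm_mul, Complex.norm_conj, norm_one] at this
    set a := ‖Zfac θ ((σ : ℂ) + t * I)‖
    set b := ‖Zfac θ ((σ : ℂ) + t * I + v * I)‖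
    set c := ‖Zfac θ (((1 - σ : ℝ) : ℂ) + t * I)‖
    set d := ‖Zfac θ (((1 - σ : ℝ) : ℂ) + t * I + v * I)‖
    have ha : 0 ≤ a := norm_nonneg _
    have hb : 0 ≤ b := norm_nonneg _
    have hc : 0 ≤ c := norm_nonneg _
    have hd : 0 ≤ d := norm_nonneg _
    obtain ⟨hdc, hcd⟩ := hw
    -- `b = a·c/d`-type manipulations without division: from `a c = 1`, `b d = 1`
    constructor
    · -- `b = a·(b c) ≤ a·(2 b d) = 2a`
      calc b = a * (b * c) := by rw [show a * (b * c) = b * (a * c) by ring, n0, mul_one]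
        _ ≤ a * (b * (2 * d)) := by gcongr
        _ = 2 * a * (b * d) := by ring
        _ = 2 * a := by rw [n1, mul_one]
    · -- `a = b·(a d) ≤ b·(2 a c) = 2b`
      calc a = b * (a * d) := by rw [show b * (a * d) = a * (b * d) by ring, n1, mul_one]
        _ ≤ b * (a * (2 * c)) := by gcongr
        _ = 2 * b * (a * c) := by ring
        _ = 2 * b := by rw [n0, mul_one]

end GammaFactor

namespace Typed.Section17

open Literature.NumberTheory.LFunctions.Zhang2022.Skeleton
open Literature.NumberTheory.LFunctions.Zhang2022.GammaFactor

/-- `L₀ ≤ log D` once `D ≥ ⌈exp L₀⌉₊`. [folklore] -/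
private theorem le_ell_of_ceil_exp_le_R {L₀ : ℝ} {D : ℕ} (hD : ⌈Real.exp L₀⌉₊ ≤ D) :
    L₀ ≤ ell D := by
  have h : Real.exp L₀ ≤ D := le_trans (Nat.le_ceil _) (by exact_mod_cast hD)
  exact (Real.le_log_iff_exp_le (lt_of_lt_of_le (Real.exp_pos _) h)).mpr h

/-- **`‖W₃‖ ≤ 2` on the closed rectangle of the move `𝔍(−α) → 𝔍(−1)` and beyond**: for every `c′`,
all large `D`, every `ψ ∈ Ψ` and every `s` with `−2 ≤ Re s ≤ 3`, `|Im s − 2πt₀| ≤ 𝓛₁ + 2`: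
`‖W₃(p,ψ(−1),s)‖ ≤ 2` (`W₃ = Z(s+β₁,ψ)/Z(s,ψ)` by `Zfac_shift_div_eq_gammaWeight17`, `β₁ = ib₁`,
`|b₁| ≤ 1`, and `GammaFactor.norm_Zfac_vshift_le_two_and` with `A = 3`).
[cite: Zhang2022LandauSiegel, §17 p. 97; §5 Lemma 5.1] -/
theorem norm_gammaWeight17_le_two (c' : ℝ) :
    ForAllLarge fun D _ _ => ∀ x : Chr D, ∀ s : ℂ, -2 ≤ s.re → s.re ≤ 3 →
      |s.im - 2 * π * t0 D| ≤ ell1 D + 2 →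
        ‖gammaWeight17 c' D x.p (x.ψ (-1)) s‖ ≤ 2 := by
  refine ForAllLarge.of_le (max 3 ⌈Real.exp (π * |c'| + 3)⌉₊) fun D _ χ hD _ _ x s hre1 hre2 him => ?_
  have hD3 : 3 ≤ D := le_trans (le_max_left _ _) hD
  have hℓc : π * |c'| + 3 ≤ ell D := le_ell_of_ceil_exp_le_R (le_trans (le_max_right _ _) hD)
  have hℓ3 : 3 ≤ ell D := by nlinarith [Real.pi_pos, abs_nonneg c']
  have hℓ1 : 1 ≤ ell D := by linarith
  obtain ⟨hα0, hα6, -⟩ := Step8u016.alpha_small hℓ3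
  have hc8 : π * |c'| ≤ ell D ^ 8 := by
    have : ell D ≤ ell D ^ 8 := by
      calc ell D = ell D ^ 1 := (pow_one _).symm
        _ ≤ ell D ^ 8 := pow_le_pow_right₀ hℓ1 (by norm_num)
    linarith
  have hcα := Step8u016.abs_c_mul_alpha_ell_le_one (c' := c') hℓ3 hc8
  obtain ⟨hb1, -, -⟩ := Step8u016.abs_b_le_one c' hα0.le hα6 hcα
  obtain ⟨e1, -, -⟩ := Section8aStatements.beta_eq_b_mul_I c' D
  -- the height: `t ≥ 2πt₀ − 𝓛₁ − 2 ≥ 3𝓛⁵¹⁹ ≥ 48`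
  obtain ⟨hwin, -, ht01, -, hℓ10⟩ := Step8u016.window_sizes hℓ3
  have ht0eq : t0 D = ell D ^ 519 := rfl
  have hℓ1eq : ell1 D = ell D ^ 405 := rfl
  have h405 : ell D ^ 405 ≤ ell D ^ 519 := pow_le_pow_right₀ hℓ1 (by norm_num)
  have h519 : (3 : ℝ) ^ 4 ≤ ell D ^ 519 := by
    calc (3 : ℝ) ^ 4 ≤ ell D ^ 4 := pow_le_pow_left₀ (by norm_num) hℓ3 4
      _ ≤ ell D ^ 519 := pow_le_pow_right₀ hℓ1 (by norm_num)
  set t : ℝ := s.im with htdef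
  have htlow : 3 * ell D ^ 519 ≤ t := by
    have h1 := (abs_le.mp him).1
    rw [hℓ1eq, ht0eq] at h1
    nlinarith [Real.pi_gt_three]
  have ht243 : 243 ≤ t := by norm_num at h519; linarith
  have ht12 : 4 * 3 ≤ t := by linarith
  have ht0 : 0 < t := by linarith
  -- apply the ratio bound with `A = 3`, `σ = Re s`, `v = b₁`
  have hv : |b1 c' D| ≤ t / 2 := by linarith
  have hsmall : (2 * |b1 c' D| + 4 * 3 + 10) * |b1 c' D| / t ≤ 1 / 2 := by
    rw [div_le_iff₀ ht0]
    have h0 : 0 ≤ |b1 c' D| := abs_nonneg _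
    have h1 : (2 * |b1 c' D| + 4 * 3 + 10) * |b1 c' D| ≤ 24 := by nlinarith
    linarith
  have hs : s = ((s.re : ℝ) : ℂ) + t * I := by
    apply Complex.ext <;> simp [htdef]
  have hratio := norm_Zfac_vshift_le_two_and x.prim (A := 3) (σ := s.re) (t := t) (v := b1 c' D)
    (by norm_num) (by linarith) (by linarith) ht12 hv hsmall
  obtain ⟨hup, hdown⟩ := hratio
  -- `W₃ = Z(s+β₁)/Z(s)`
  have hs0 : 0 < s.im := ht0
  have hs1 : 0 < (s + beta1 c' D).im := by
    rw [e1]; simp; linarith [(abs_le.mp hb1).1]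
  have hsv : s + beta1 c' D = ((s.re : ℝ) : ℂ) + t * I + (b1 c' D : ℂ) * I := by
    rw [e1]; conv_lhs => rw [hs]
  have hZne : Zfac x.ψ s ≠ 0 := Zfac_ne_zero x.prim hs0
  rw [← Zfac_shift_div_eq_gammaWeight17 c' x hs0 hs1, norm_div, div_le_iff₀ (norm_pos_iff.mpr hZne),
    hsv]
  conv_rhs => rw [hs]
  exact hup

end Typed.Section17

end Literature.NumberTheory.LFunctions.Zhang2022
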